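import Mathlib
import Literature.NumberTheory.Automorphic.TwistedQuotientConeDescentStep
import HarnessLib

/-!
# The descent step does not lose polynomial growth — crux HeckeEigenvalueField
# (stmt-Langlands-13632), line Sketch, stub `stub_growth_step`

Setting of `Literature.NumberTheory.Automorphic.TwistedQuotientConeDescent{,Rows,Step}` (a linear
action `a` of `Γ` on `W` preserving an open `X`, a `Γ`-partition of unity `ψ` on `X`, the descent
correction `T_ψ(λ, κ)(g) = ∑ᶠ_γ dψ_γ ∧ λ(γ, g) + ψ_γ • δκ(γ, g)`, `ψ_γ = ψ ∘ a γ⁻¹`, of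
`TwistedQuotient.descent_step`).  **Statement.**  On `F' ⊆ X`, where only the `ψ_γ` with `γ ∈ Δ`
(finite) are alive nearby, with polynomial `C²` bounds in a size function `sz ≥ 1`, polynomial `C¹`
bounds for `λ`, `κ` at all tuples from `Δ` pass to `κ - T_ψ(λ, κ)`.  **Proof.**  Near `x ∈ F'`, `T`
is the FINITE sum over `γ ∈ Δ` (`cochT_eventuallyEq_sum`, from the tree's `cochT_apply_eq_sum`);
pointwise `‖dψ_γ ∧ β‖ ≤ r ‖dψ_γ‖ ‖β‖` (`norm_alternatizeUncurryFin_le`), `‖δκ(G)‖ ≤ ∑ faces`, and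
Leibniz for the derivatives (`D(dψ_γ ∧ β)` is the alternatisation of `dψ_γ ⊗ Dβ + D²ψ_γ ⊗ β`,
`ContinuousLinearMap.hasFDerivAt_of_bilinear` for the rank-one pairing; `D(ψ_γ δκ) = ψ_γ Dδκ +
dψ_γ ⊗ δκ`); faces of `(γ, g)` stay in `Δ`; polynomial bounds are closed under `+`, `*` (`sz ≥ 1`).

## References

* R. Bott, L. W. Tu, *Differential Forms in Algebraic Topology*, GTM 82 (1982), §II.9.
  [BottTu1982Forms]
* A. Borel, *Regularization theorems in Lie algebra cohomology. Applications*, Duke Math. J. 50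
  (1983), §3. [Borel1983Regularization]
-/

set_option linter.dupNamespace false -- the mandated namespace `Summit.Langlands.Langlands`

noncomputable section

open Filter Topology Set Literature.NumberTheory.Automorphic
  Literature.NumberTheory.Automorphic.TwistedQuotient
open scoped ContDiff Topology

namespace Summit.Langlands.Langlands.Theorems.HeckeEigenvalueField.Res

namespace GrowthStep

section Bdd

variable {α : Type*} {F' : Set α} {sz : α → ℝ}

/-- Two polynomial bounds have a common constant and exponent (enlarge both, `sz ≥ 1`). -/
theorem bdd_and (hsz : ∀ x ∈ F', 1 ≤ sz x) {u v : α → ℝ}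
    (hu : ∃ (C : ℝ) (k : ℕ), ∀ x ∈ F', u x ≤ C * sz x ^ k)
    (hv : ∃ (C : ℝ) (k : ℕ), ∀ x ∈ F', v x ≤ C * sz x ^ k) :
    ∃ (C : ℝ) (k : ℕ), ∀ x ∈ F', u x ≤ C * sz x ^ k ∧ v x ≤ C * sz x ^ k := by
  have key : ∀ {w : α → ℝ} {C D : ℝ} {k m : ℕ}, (∀ x ∈ F', w x ≤ C * sz x ^ k) →
      ∀ x ∈ F', w x ≤ (|C| + |D|) * sz x ^ (k + m) := fun h x hx =>
    have h0 : (0 : ℝ) ≤ sz x := zero_le_one.trans (hsz x hx)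
    (h x hx).trans <| (mul_le_mul_of_nonneg_right (le_abs_self _) (pow_nonneg h0 _)).trans <|
      mul_le_mul (le_add_of_nonneg_right (abs_nonneg _)) (pow_le_pow_right₀ (hsz x hx)
        (Nat.le_add_right _ _)) (pow_nonneg h0 _) (add_nonneg (abs_nonneg _) (abs_nonneg _))
  obtain ⟨⟨C₁, k₁, h₁⟩, C₂, k₂, h₂⟩ := And.intro hu hv
  refine ⟨|C₁| + |C₂|, k₁ + k₂, fun x hx => ⟨key h₁ x hx, ?_⟩⟩
  rw [add_comm |C₁|, add_comm k₁]
  exact key h₂ x hx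

/-- Polynomial bounds are stable under sums. [folklore] -/
theorem bdd_add (hsz : ∀ x ∈ F', 1 ≤ sz x) {u v : α → ℝ}
    (hu : ∃ (C : ℝ) (k : ℕ), ∀ x ∈ F', u x ≤ C * sz x ^ k)
    (hv : ∃ (C : ℝ) (k : ℕ), ∀ x ∈ F', v x ≤ C * sz x ^ k) :
    ∃ (C : ℝ) (k : ℕ), ∀ x ∈ F', u x + v x ≤ C * sz x ^ k := by
  obtain ⟨C, k, h⟩ := bdd_and hsz hu hv
  exact ⟨2 * C, k, fun x hx => by rw [two_mul, add_mul]; exact add_le_add (h x hx).1 (h x hx).2⟩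

/-- Polynomial bounds are stable under finite sums. [folklore] -/
theorem bdd_sum {ι : Type*} (S : Finset ι) (hsz : ∀ x ∈ F', 1 ≤ sz x) {u : ι → α → ℝ}
    (hu : ∀ i ∈ S, ∃ (C : ℝ) (k : ℕ), ∀ x ∈ F', u i x ≤ C * sz x ^ k) :
    ∃ (C : ℝ) (k : ℕ), ∀ x ∈ F', ∑ i ∈ S, u i x ≤ C * sz x ^ k := by
  classical
  induction S using Finset.induction_on with
  | empty => exact ⟨0, 0, fun x _ => by simp⟩
  | insert j S hj ih =>
    simpa only [Finset.sum_insert hj] using bdd_add hsz (hu j (Finset.mem_insert_self j S))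
      (ih fun i hi => hu i (Finset.mem_insert_of_mem hi))

/-- Polynomial bounds are stable under products (second factor non-negative). [folklore] -/
theorem bdd_mul (hsz : ∀ x ∈ F', 1 ≤ sz x) {u v : α → ℝ}
    (hu : ∃ (C : ℝ) (k : ℕ), ∀ x ∈ F', u x ≤ C * sz x ^ k)
    (hv : ∃ (C : ℝ) (k : ℕ), ∀ x ∈ F', v x ≤ C * sz x ^ k) (hv0 : ∀ x ∈ F', 0 ≤ v x) :
    ∃ (C : ℝ) (k : ℕ), ∀ x ∈ F', u x * v x ≤ C * sz x ^ k := by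
  obtain ⟨C, k, h⟩ := bdd_and hsz hu hv
  refine ⟨C * C, k + k, fun x hx => ?_⟩
  rw [pow_add, mul_mul_mul_comm]
  exact mul_le_mul (h x hx).1 (h x hx).2 (hv0 x hx) ((hv0 x hx).trans (h x hx).2)

/-- A polynomial bound passes to a pointwise smaller function. [folklore] -/
theorem bdd_mono {u v : α → ℝ} (hv : ∃ (C : ℝ) (k : ℕ), ∀ x ∈ F', v x ≤ C * sz x ^ k)
    (huv : ∀ x ∈ F', u x ≤ v x) : ∃ (C : ℝ) (k : ℕ), ∀ x ∈ F', u x ≤ C * sz x ^ k :=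
  hv.imp fun _ => Exists.imp fun _ h x hx => (huv x hx).trans (h x hx)

/-- Non-negative constant multiples preserve polynomial bounds. [folklore] -/
theorem bdd_const_mul {u : α → ℝ} (M : ℝ) (hM : 0 ≤ M)
    (hu : ∃ (C : ℝ) (k : ℕ), ∀ x ∈ F', u x ≤ C * sz x ^ k) :
    ∃ (C : ℝ) (k : ℕ), ∀ x ∈ F', M * u x ≤ C * sz x ^ k := by
  obtain ⟨C, k, h⟩ := hu
  exact ⟨M * C, k, fun x hx => by rw [mul_assoc]; exact mul_le_mul_of_nonneg_left (h x hx) hM⟩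

end Bdd

section Forms

variable {Γ 𝒢 : Type} [Group 𝒢] (L : Subgroup 𝒢)
  {V : Type} [NormedAddCommGroup V] [NormedSpace ℂ V]
  {W : Type} [NormedAddCommGroup W] [NormedSpace ℝ W]

/-- A component of `δφ` as a function of the point: the signed sum of the faces. [folklore] -/
theorem delta_eq_fun {p : ℕ} (φ : Coch Γ L W V p) (G : Fin (p + 2) → Γ) (c : 𝒢 ⧸ L) (r : ℕ) :
    delta L φ G c r = fun y => ∑ i : Fin (p + 2),
      ((-1 : ℝ) ^ (i : ℕ)) • φ (fun j => G (i.succAbove j)) c r y := by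
  funext y
  simp only [delta_apply, Finset.sum_apply, Pi.smul_apply]

/-- `‖(δφ)(G)(x)‖ ≤ ∑ᵢ ‖φ(∂ᵢ G)(x)‖`. [folklore] -/
theorem norm_delta_le {p : ℕ} (φ : Coch Γ L W V p) (G : Fin (p + 2) → Γ) (c : 𝒢 ⧸ L) (r : ℕ)
    (x : W) : ‖delta L φ G c r x‖ ≤ ∑ i : Fin (p + 2), ‖φ (fun j => G (i.succAbove j)) c r x‖ := by
  rw [delta_eq_fun]
  refine (norm_sum_le _ _).trans (le_of_eq (Finset.sum_congr rfl fun i _ => ?_))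
  rw [norm_smul, norm_pow, norm_neg, norm_one, one_pow, one_mul]

/-- `δφ(G)` is differentiable at a point where all faces are, and
`‖D(δφ)(G)(x)‖ ≤ ∑ᵢ ‖D φ(∂ᵢ G)(x)‖`. [folklore] -/
theorem fderiv_delta {p : ℕ} (φ : Coch Γ L W V p) (G : Fin (p + 2) → Γ) (c : 𝒢 ⧸ L) (r : ℕ)
    {x : W} (hφ : ∀ i : Fin (p + 2), DifferentiableAt ℝ (φ (fun j => G (i.succAbove j)) c r) x) :
    DifferentiableAt ℝ (delta L φ G c r) x ∧ ‖fderiv ℝ (delta L φ G c r) x‖ ≤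
      ∑ i : Fin (p + 2), ‖fderiv ℝ (φ (fun j => G (i.succAbove j)) c r) x‖ := by
  rw [delta_eq_fun, fderiv_fun_sum fun i _ => (hφ i).fun_const_smul _]
  refine ⟨DifferentiableAt.fun_sum fun i _ => (hφ i).fun_const_smul _,
    (norm_sum_le Finset.univ fun i : Fin (p + 2) => fderiv ℝ (fun y => ((-1 : ℝ) ^ (i : ℕ)) •
      φ (fun j => G (i.succAbove j)) c r y) x).trans (Finset.sum_le_sum fun i _ => ?_)⟩
  rw [fderiv_fun_const_smul (hφ i)]
  refine (ContinuousLinearMap.opNorm_smul_le ((-1 : ℝ) ^ (i : ℕ))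
    (fderiv ℝ (φ (fun j => G (i.succAbove j)) c r) x)).trans (le_of_eq ?_)
  rw [norm_pow, norm_neg, norm_one, one_pow, one_mul]

/-- `‖df ∧ α‖ ≤ r ‖df‖ ‖α‖` pointwise (`norm_alternatizeUncurryFin_le`; nothing in degree `0`).
[folklore] -/
theorem norm_wedgeD_le (f : W → ℝ) (α : TFam L W V) (c : 𝒢 ⧸ L) (r : ℕ) (x : W) :
    ‖wedgeD L f α c r x‖ ≤ r * (‖fderiv ℝ f x‖ * ‖α c (r - 1) x‖) := by
  cases r with
  | zero => simp
  | succ r =>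
    rw [wedgeD_succ]
    refine (ContinuousAlternatingMap.norm_alternatizeUncurryFin_le _).trans (le_of_eq ?_)
    rw [ContinuousLinearMap.norm_smulRight_apply, Nat.cast_succ, Nat.add_sub_cancel]

/-- **Leibniz for the Leibniz term** (positive degree): the derivative of `y ↦ df(y) ∧ α(y)` is the
alternatisation of `w ↦ df(x) ⊗ Dα(x)w + D²f(x)w ⊗ α(x)` (`hasFDerivAt_of_bilinear`). [folklore] -/
theorem hasFDerivAt_wedgeD {f : W → ℝ} {α : TFam L W V} {c : 𝒢 ⧸ L} {r : ℕ} {x : W}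
    (hf : DifferentiableAt ℝ (fderiv ℝ f) x) (hα : DifferentiableAt ℝ (α c r) x) :
    ∃ D : W →L[ℝ] (W →L[ℝ] W [⋀^Fin r]→L[ℝ] V),
      HasFDerivAt (wedgeD L f α c (r + 1))
        ((ContinuousAlternatingMap.alternatizeUncurryFinCLM ℝ W V).comp D) x ∧
      ∀ w, D w = (fderiv ℝ f x).smulRight (fderiv ℝ (α c r) x w) +
        (fderiv ℝ (fderiv ℝ f) x w).smulRight (α c r x) := by
  have h := ContinuousLinearMap.hasFDerivAt_of_bilinear (G := W →L[ℝ] (W [⋀^Fin r]→L[ℝ] V))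
    (B := ContinuousLinearMap.smulRightL ℝ W (W [⋀^Fin r]→L[ℝ] V)) hf.hasFDerivAt hα.hasFDerivAt
  have hw : wedgeD L f α c (r + 1) = fun y => ContinuousAlternatingMap.alternatizeUncurryFinCLM ℝ W
      V (ContinuousLinearMap.smulRightL ℝ W (W [⋀^Fin r]→L[ℝ] V) (fderiv ℝ f y) (α c r y)) :=
    funext fun y => rfl
  rw [hw]
  exact ⟨_, (ContinuousAlternatingMap.alternatizeUncurryFinCLM ℝ W V).hasFDerivAt.comp x h,
    fun w => rfl⟩

/-- The Leibniz term is differentiable where `df` and `α` are, with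
`‖D(df ∧ α)‖ ≤ r (‖df‖ ‖Dα‖ + ‖D²f‖ ‖α‖)` (operator norm bounded vector by vector). [folklore] -/
theorem fderiv_wedgeD {f : W → ℝ} {α : TFam L W V} {c : 𝒢 ⧸ L} (r : ℕ) {x : W}
    (hf : DifferentiableAt ℝ (fderiv ℝ f) x) (hα : DifferentiableAt ℝ (α c (r - 1)) x) :
    DifferentiableAt ℝ (wedgeD L f α c r) x ∧
      ‖fderiv ℝ (wedgeD L f α c r) x‖ ≤ r * (‖fderiv ℝ f x‖ * ‖fderiv ℝ (α c (r - 1)) x‖ +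
        ‖fderiv ℝ (fderiv ℝ f) x‖ * ‖α c (r - 1) x‖) := by
  cases r with
  | zero =>
    have h0 : wedgeD L f α c 0 = fun _ => (0 : W [⋀^Fin 0]→L[ℝ] V) := funext fun y => rfl
    rw [h0, fderiv_const_apply, ContinuousLinearMap.opNorm_zero]
    exact ⟨differentiableAt_const _, by simp⟩
  | succ r =>
    rw [Nat.add_sub_cancel] at hα ⊢
    obtain ⟨D, hD, hDw⟩ := hasFDerivAt_wedgeD L hf hα
    refine ⟨hD.differentiableAt, ?_⟩
    rw [hD.fderiv, Nat.cast_succ]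
    refine ContinuousLinearMap.opNorm_le_bound _ (by positivity) fun w => ?_
    rw [ContinuousLinearMap.comp_apply, hDw w,
      ContinuousAlternatingMap.alternatizeUncurryFinCLM_apply]
    set S₁ := (fderiv ℝ f x).smulRight (fderiv ℝ (α c r) x w)
    set S₂ := (fderiv ℝ (fderiv ℝ f) x w).smulRight (α c r x)
    have h₁ : ‖S₁‖ ≤ ‖fderiv ℝ f x‖ * ‖fderiv ℝ (α c r) x‖ * ‖w‖ := by
      rw [ContinuousLinearMap.norm_smulRight_apply, mul_assoc]
      exact mul_le_mul_of_nonneg_left ((fderiv ℝ (α c r) x).le_opNorm w)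
        (norm_nonneg (fderiv ℝ f x))
    have h₂ : ‖S₂‖ ≤ ‖fderiv ℝ (fderiv ℝ f) x‖ * ‖α c r x‖ * ‖w‖ := by
      rw [ContinuousLinearMap.norm_smulRight_apply, mul_right_comm]
      exact mul_le_mul_of_nonneg_right ((fderiv ℝ (fderiv ℝ f) x).le_opNorm w)
        (norm_nonneg (α c r x))
    calc ‖ContinuousAlternatingMap.alternatizeUncurryFin (S₁ + S₂)‖ ≤ ((r : ℝ) + 1) * ‖S₁ + S₂‖ :=
          ContinuousAlternatingMap.norm_alternatizeUncurryFin_le _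
      _ ≤ ((r : ℝ) + 1) * (‖fderiv ℝ f x‖ * ‖fderiv ℝ (α c r) x‖ * ‖w‖ +
            ‖fderiv ℝ (fderiv ℝ f) x‖ * ‖α c r x‖ * ‖w‖) :=
          mul_le_mul_of_nonneg_left ((norm_add_le S₁ S₂).trans (add_le_add h₁ h₂)) (by positivity)
      _ = _ := by ring

/-- `‖D(f • β)‖ ≤ |f| ‖Dβ‖ + ‖Df‖ ‖β‖` pointwise. [folklore] -/
theorem norm_fderiv_smul_le {M : Type*} [NormedAddCommGroup M] [NormedSpace ℝ M] {f : W → ℝ}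
    {β : W → M} {x : W} (hf : DifferentiableAt ℝ f x) (hβ : DifferentiableAt ℝ β x) :
    ‖fderiv ℝ (fun y => f y • β y) x‖ ≤ |f x| * ‖fderiv ℝ β x‖ + ‖fderiv ℝ f x‖ * ‖β x‖ := by
  rw [fderiv_fun_smul hf hβ, ← Real.norm_eq_abs]
  exact (norm_add_le (f x • fderiv ℝ β x) ((fderiv ℝ f x).smulRight (β x))).trans
    (add_le_add (ContinuousLinearMap.opNorm_smul_le (f x) (fderiv ℝ β x))
      (le_of_eq (ContinuousLinearMap.norm_smulRight_apply (fderiv ℝ f x) (β x))))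

/-- **Polynomial `C¹` growth of a descent summand** `y ↦ df(y) ∧ α(y) + f(y) δφ(G)(y)` on `F' ⊆ X`
from polynomial `C²` bounds on `f` and `C¹` bounds on `α` and on the faces of `φ` (all smooth on the
open `X`): pointwise `‖df ∧ α + f δφ(G)‖ ≤ r ‖Df‖ ‖α‖ + |f| ∑ faces` and, by Leibniz,
`‖D(df ∧ α + f δφ(G))‖ ≤ r (‖Df‖ ‖Dα‖ + ‖D²f‖ ‖α‖) + |f| ∑ ‖D faces‖ + ‖Df‖ ∑ ‖faces‖`.
[folklore] -/
theorem bdd_T {X F' : Set W} (hF' : F' ⊆ X) (hXo : IsOpen X) {sz : W → ℝ}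
    (hsz : ∀ x ∈ F', 1 ≤ sz x) {f : W → ℝ} (hfs : ∀ x ∈ X, ContDiffAt ℝ ∞ f x)
    (hfb : ∃ (C : ℝ) (k : ℕ), ∀ x ∈ F', |f x| ≤ C * sz x ^ k ∧ ‖fderiv ℝ f x‖ ≤ C * sz x ^ k ∧
      ‖iteratedFDeriv ℝ 2 f x‖ ≤ C * sz x ^ k)
    {α : TFam L W V} (hαs : ∀ (c : 𝒢 ⧸ L) (r : ℕ), ContDiffOn ℝ ∞ (α c r) X)
    {p : ℕ} {φ : Coch Γ L W V p} (hφs : SmoothOn L X φ) (G : Fin (p + 2) → Γ) (c : 𝒢 ⧸ L)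
    (r : ℕ) (hαb : ∃ (C : ℝ) (k : ℕ), ∀ x ∈ F', ‖α c (r - 1) x‖ ≤ C * sz x ^ k ∧
      ‖fderiv ℝ (α c (r - 1)) x‖ ≤ C * sz x ^ k)
    (hφb : ∀ i : Fin (p + 2), ∃ (C : ℝ) (k : ℕ), ∀ x ∈ F',
      ‖φ (fun j => G (i.succAbove j)) c r x‖ ≤ C * sz x ^ k ∧
        ‖fderiv ℝ (φ (fun j => G (i.succAbove j)) c r) x‖ ≤ C * sz x ^ k) :
    (∃ (C : ℝ) (k : ℕ), ∀ x ∈ F', ‖wedgeD L f α c r x + f x • delta L φ G c r x‖ ≤ C * sz x ^ k) ∧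
    (∀ x ∈ X, DifferentiableAt ℝ (fun y => wedgeD L f α c r y + f y • delta L φ G c r y) x) ∧
    ∃ (C : ℝ) (k : ℕ), ∀ x ∈ F',
      ‖fderiv ℝ (fun y => wedgeD L f α c r y + f y • delta L φ G c r y) x‖ ≤ C * sz x ^ k := by
  -- differentiability and the Leibniz estimates at the points of the open `X`
  have hf1 : ∀ x ∈ X, DifferentiableAt ℝ f x := fun x hx => (hfs x hx).differentiableAt (by simp)
  have hw := fun x (hx : x ∈ X) => fderiv_wedgeD L r
    (((hfs x hx).fderiv_right (m := ∞) (by simp)).differentiableAt (by simp))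
    (((hαs c (r - 1)).contDiffAt (hXo.mem_nhds hx)).differentiableAt (by simp))
  have hδ := fun x (hx : x ∈ X) => fderiv_delta L φ G c r (x := x) fun i =>
    ((hφs (fun j => G (i.succAbove j)) c r).contDiffAt (hXo.mem_nhds hx)).differentiableAt (by simp)
  have hsm : ∀ x ∈ X, DifferentiableAt ℝ (fun y => f y • delta L φ G c r y) x :=
    fun x hx => (hf1 x hx).fun_smul (hδ x hx).1
  -- the atoms `|f|, ‖Df‖, ‖D²f‖, ‖α‖, ‖Dα‖, ∑ ‖faces‖, ∑ ‖D faces‖` are polynomially bounded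
  have hA0 := hfb.imp fun _ => Exists.imp fun _ h x hx => (h x hx).1
  have hA1 := hfb.imp fun _ => Exists.imp fun _ h x hx => (h x hx).2.1
  have hA2 : ∃ (C : ℝ) (k : ℕ), ∀ x ∈ F', ‖fderiv ℝ (fderiv ℝ f) x‖ ≤ C * sz x ^ k := by
    refine hfb.imp fun _ => Exists.imp fun _ h x hx => ?_
    rw [← norm_iteratedFDeriv_one (𝕜 := ℝ) (fderiv ℝ f), norm_iteratedFDeriv_fderiv]
    exact (h x hx).2.2
  have hB0 := hαb.imp fun _ => Exists.imp fun _ h x hx => (h x hx).1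
  have hB1 := hαb.imp fun _ => Exists.imp fun _ h x hx => (h x hx).2
  have hK0 := bdd_sum Finset.univ hsz fun i _ =>
    (hφb i).imp fun _ => Exists.imp fun _ h x hx => (h x hx).1
  have hK1 := bdd_sum Finset.univ hsz fun i _ =>
    (hφb i).imp fun _ => Exists.imp fun _ h x hx => (h x hx).2
  have hB0n : ∀ x ∈ F', 0 ≤ ‖α c (r - 1) x‖ := fun x _ => norm_nonneg (α c (r - 1) x)
  have hK0n : ∀ x ∈ F', 0 ≤ ∑ i : Fin (p + 2), ‖φ (fun j => G (i.succAbove j)) c r x‖ :=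
    fun x _ => Finset.sum_nonneg fun i _ => norm_nonneg (φ (fun j => G (i.succAbove j)) c r x)
  have hr : (0 : ℝ) ≤ r := Nat.cast_nonneg r
  refine ⟨bdd_mono (bdd_add hsz (bdd_const_mul (r : ℝ) hr (bdd_mul hsz hA1 hB0 hB0n))
      (bdd_mul hsz hA0 hK0 hK0n)) fun x _ => ?_, fun x hx => (hw x hx).1.fun_add (hsm x hx),
    bdd_mono (bdd_add hsz (bdd_const_mul (r : ℝ) hr (bdd_add hsz
      (bdd_mul hsz hA1 hB1 fun x _ => norm_nonneg (fderiv ℝ (α c (r - 1)) x))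
      (bdd_mul hsz hA2 hB0 hB0n))) (bdd_add hsz (bdd_mul hsz hA0 hK1 fun x _ =>
        Finset.sum_nonneg fun i _ => norm_nonneg (fderiv ℝ (φ (fun j => G (i.succAbove j)) c r) x))
      (bdd_mul hsz hA1 hK0 hK0n))) fun x hx => ?_⟩
  · -- the value: `‖df ∧ α‖ ≤ r ‖Df‖ ‖α‖` and `‖δφ(G)‖ ≤ ∑ faces`
    refine (norm_add_le _ _).trans (add_le_add (norm_wedgeD_le L f α c r x) ?_)
    rw [norm_smul, Real.norm_eq_abs]
    exact mul_le_mul_of_nonneg_left (norm_delta_le L φ G c r x) (abs_nonneg _)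
  · -- the derivative: Leibniz
    have hx' : x ∈ X := hF' hx
    rw [fderiv_fun_add (hw x hx').1 (hsm x hx')]
    exact (norm_add_le (fderiv ℝ (wedgeD L f α c r) x) _).trans (add_le_add (hw x hx').2
      ((norm_fderiv_smul_le (hf1 x hx') (hδ x hx').1).trans (add_le_add
        (mul_le_mul_of_nonneg_left (hδ x hx').2 (abs_nonneg (f x)))
        (mul_le_mul_of_nonneg_left (norm_delta_le L φ G c r x) (norm_nonneg (fderiv ℝ f x))))))

end Forms

section Local

variable {Γ 𝒢 : Type} [Group Γ] [Group 𝒢] (L : Subgroup 𝒢)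
  {V : Type} [NormedAddCommGroup V] [NormedSpace ℂ V]
  {W : Type} [NormedAddCommGroup W] [NormedSpace ℝ W]
  (a : Γ →* (W →L[ℝ] W)) {ψ : W → ℝ}

/-- **Near a point where only the translates `ψ ∘ a γ⁻¹`, `γ ∈ Δ`, are alive, `T_ψ(λ, κ)(g)` is the
FINITE sum over `γ ∈ Δ`** of `dψ_γ ∧ λ(γ, g) + ψ_γ • δκ(γ, g)`, as functions near the point (the
tree's `cochT_apply_eq_sum` over `s ∪ Δ`; the summands with `γ ∉ Δ` vanish identically nearby).
[cite: BottTu1982Forms, §II.9] -/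
theorem cochT_eventuallyEq_sum {p : ℕ} (lam : Coch Γ L W V (p + 1)) (κ : Coch Γ L W V p)
    (g : Fin (p + 1) → Γ) (c : 𝒢 ⧸ L) (r : ℕ) {x : W} {U : Set W} (hU : U ∈ 𝓝 x) {s : Finset Γ}
    (hs : ∀ y ∈ U, ∀ γ : Γ, ψ (a γ⁻¹ y) ≠ 0 → γ ∈ s) (Δ : Finset Γ)
    (hΔ : ∀ γ : Γ, γ ∉ Δ → (fun y => ψ (a γ⁻¹ y)) =ᶠ[𝓝 x] fun _ => 0) :
    cochT L a ψ lam κ g c r =ᶠ[𝓝 x] fun y => ∑ γ ∈ Δ,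
      (wedgeD L (fun y => ψ (a γ⁻¹ y)) (lam (Fin.cons γ g)) c r y +
        ψ (a γ⁻¹ y) • delta L κ (Fin.cons γ g) c r y) := by
  classical
  -- near `x`, `T` is the finite sum over `s ∪ Δ`, and the summands with `γ ∉ Δ` vanish
  have h1 : ∀ᶠ y in 𝓝 x, cochT L a ψ lam κ g c r y = ∑ γ ∈ s ∪ Δ,
      (wedgeD L (fun y => ψ (a γ⁻¹ y)) (lam (Fin.cons γ g)) c r y +
        ψ (a γ⁻¹ y) • delta L κ (Fin.cons γ g) c r y) := by
    filter_upwards [eventually_mem_nhds_iff.2 hU] with y hy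
    exact cochT_apply_eq_sum L lam κ g c r hy fun z hz γ hγ =>
      Finset.mem_union_left _ (hs z hz γ hγ)
  have h2 : ∀ᶠ y in 𝓝 x, ∀ γ ∈ s ∪ Δ, γ ∉ Δ →
      wedgeD L (fun y => ψ (a γ⁻¹ y)) (lam (Fin.cons γ g)) c r y +
        ψ (a γ⁻¹ y) • delta L κ (Fin.cons γ g) c r y = 0 := by
    refine (Filter.eventually_all_finset _).2 fun γ _ => ?_
    by_cases hγ : γ ∈ Δ
    · exact Filter.Eventually.of_forall fun y h => absurd hγ h
    · filter_upwards [(hΔ γ hγ).eventuallyEq_nhds] with y hy _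
      have hd : fderiv ℝ (fun y => ψ (a γ⁻¹ y)) y = 0 := by rw [hy.fderiv_eq, fderiv_const_apply]
      have h0 : ψ (a γ⁻¹ y) = 0 := hy.eq_of_nhds
      rw [wedgeD_eq_zero_of_fderiv L hd, h0, zero_smul, add_zero]
  filter_upwards [h1, h2] with y hy1 hy2
  rw [hy1]
  exact (Finset.sum_subset Finset.subset_union_right hy2).symm

end Local

end GrowthStep

/-- **Stub GROWTH-STEP — the descent step does not lose polynomial growth on the fundamental set
(self-regularisation).**  In the setting of `TwistedQuotient.descent_step` (same hypotheses `hd`,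
`hκ0`, so that the tree's `smoothOn_cochT`, `cochT_apply_eq_sum`, `cochT_eq_cochD_cochS_apply` apply): if, at the points of
`F' ⊆ X`, only the translates `ψ ∘ a γ⁻¹`, `γ ∈ Δ`, of the partition of unity are non-zero nearby, with
`C²` bounds polynomial in a size function `sz ≥ 1`, and `λ` and `κ` have polynomial `C¹` bounds on `F'` at
all tuples from `Δ`, then so does `κ - T_ψ(λ, κ)` (`T` is a finite sum near each point of `F'`; it does not
differentiate `λ`; Leibniz for `dψ_γ ∧ λ(γ, ·)` and `ψ_γ · δκ(γ, ·)`). [cite: BottTu1982Forms, §II.9]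
[cite: Borel1983Regularization, §3] -/
theorem stub_growth_step
    {Γ 𝒢 : Type} [Group Γ] [Group 𝒢] (L : Subgroup 𝒢)
    {V : Type} [NormedAddCommGroup V] [NormedSpace ℂ V]
    {W : Type} [NormedAddCommGroup W] [NormedSpace ℝ W] [FiniteDimensional ℝ W]
    (a : Γ →* (W →L[ℝ] W)) {X : Set W} {ψ : W → ℝ} (hψ : TwistedQuotient.IsPOU a X ψ)
    (hXo : IsOpen X) (hmaps : ∀ γ : Γ, Set.MapsTo (a γ) X X)
    (sz : W → ℝ) {F' : Set W} (hF' : F' ⊆ X) (hsz : ∀ x ∈ F', 1 ≤ sz x) (Δ : Finset Γ)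
    (hΔ : ∀ γ : Γ, γ ∉ Δ → ∀ x ∈ F', (fun y => ψ (a γ⁻¹ y)) =ᶠ[𝓝 x] fun _ => 0)
    (hψb : ∃ (C : ℝ) (k : ℕ), ∀ γ ∈ Δ, ∀ x ∈ F', |ψ (a γ⁻¹ x)| ≤ C * sz x ^ k ∧
      ‖fderiv ℝ (fun y => ψ (a γ⁻¹ y)) x‖ ≤ C * sz x ^ k ∧
      ‖iteratedFDeriv ℝ 2 (fun y => ψ (a γ⁻¹ y)) x‖ ≤ C * sz x ^ k)
    {p : ℕ} (lam : TwistedQuotient.Coch Γ L W V (p + 1)) (κ : TwistedQuotient.Coch Γ L W V p)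
    (hlamS : TwistedQuotient.SmoothOn L X lam) (hκS : TwistedQuotient.SmoothOn L X κ)
    (hd : ∀ (g : Fin (p + 2) → Γ) (c : 𝒢 ⧸ L) (r : ℕ), ∀ x ∈ X,
      TwistedQuotient.cochD L lam g c r x = TwistedQuotient.delta L κ g c r x)
    (hκ0 : ∀ (g : Fin (p + 2) → Γ) (c : 𝒢 ⧸ L), ∀ x ∈ X, TwistedQuotient.delta L κ g c 0 x = 0)
    (hlam : ∀ g : Fin (p + 2) → Γ, (∀ i, g i ∈ Δ) → ∀ (c : 𝒢 ⧸ L) (r : ℕ), ∃ (C : ℝ) (k : ℕ),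
      ∀ x ∈ F', ‖lam g c r x‖ ≤ C * sz x ^ k ∧ ‖fderiv ℝ (lam g c r) x‖ ≤ C * sz x ^ k)
    (hκ : ∀ g : Fin (p + 1) → Γ, (∀ i, g i ∈ Δ) → ∀ (c : 𝒢 ⧸ L) (r : ℕ), ∃ (C : ℝ) (k : ℕ),
      ∀ x ∈ F', ‖κ g c r x‖ ≤ C * sz x ^ k ∧ ‖fderiv ℝ (κ g c r) x‖ ≤ C * sz x ^ k) :
    ∀ g : Fin (p + 1) → Γ, (∀ i, g i ∈ Δ) → ∀ (c : 𝒢 ⧸ L) (r : ℕ), ∃ (C : ℝ) (k : ℕ),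
      ∀ x ∈ F', ‖(κ - TwistedQuotient.cochT L a ψ lam κ) g c r x‖ ≤ C * sz x ^ k ∧
        ‖fderiv ℝ ((κ - TwistedQuotient.cochT L a ψ lam κ) g c r) x‖ ≤ C * sz x ^ k := by
  intro g hg c r
  -- extended tuples `(γ, g)` with `γ ∈ Δ` have all their entries (hence all their faces) in `Δ`
  have hG : ∀ γ ∈ Δ, ∀ i, (Fin.cons γ g : Fin (p + 2) → Γ) i ∈ Δ := fun γ hγ i => by
    refine Fin.cases ?_ (fun j => ?_) i
    · simpa using hγ
    · simpa using hg j
  obtain ⟨Cψ, kψ, hψb⟩ := hψb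
  -- polynomial `C¹` growth of each summand `dψ_γ ∧ λ(γ, g) + ψ_γ • δκ(γ, g)`, `γ ∈ Δ`
  have hT := fun γ (hγ : γ ∈ Δ) =>
    GrowthStep.bdd_T L hF' hXo hsz (fun x hx => hψ.contDiffAt_psi hXo hmaps γ hx)
      ⟨Cψ, kψ, fun x hx => hψb γ hγ x hx⟩ (α := lam (Fin.cons γ g)) (fun c' r' => hlamS _ c' r') hκS
      (Fin.cons γ g) c r (hlam _ (hG γ hγ) c (r - 1))
      fun i => hκ _ (fun j => hG γ hγ (i.succAbove j)) c r
  obtain ⟨Cκ, kκ, hκg⟩ := hκ g hg c r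
  obtain ⟨C, k, hCk⟩ := GrowthStep.bdd_and hsz
    (GrowthStep.bdd_add hsz ⟨Cκ, kκ, fun x hx => (hκg x hx).1⟩
      (GrowthStep.bdd_sum Δ hsz fun γ hγ => (hT γ hγ).1))
    (GrowthStep.bdd_add hsz ⟨Cκ, kκ, fun x hx => (hκg x hx).2⟩
      (GrowthStep.bdd_sum Δ hsz fun γ hγ => (hT γ hγ).2.2))
  refine ⟨C, k, fun x hxF => ?_⟩
  have hx : x ∈ X := hF' hxF
  obtain ⟨U, hU, s, hs⟩ := hψ.exists_finset hx
  have hTeq := GrowthStep.cochT_eventuallyEq_sum L a lam κ g c r hU hs Δ fun γ hγ => hΔ γ hγ x hxF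
  have hκd : DifferentiableAt ℝ (κ g c r) x :=
    ((hκS g c r).contDiffAt (hXo.mem_nhds hx)).differentiableAt (by simp)
  have hTd : DifferentiableAt ℝ (cochT L a ψ lam κ g c r) x :=
    ((smoothOn_cochT L a hψ hXo hmaps hlamS hd hκ0 g c r).contDiffAt
      (hXo.mem_nhds hx)).differentiableAt (by simp)
  -- the value and the derivative of `T` at `x` are those of the finite sum over `Δ`
  obtain ⟨h1, h2⟩ := hCk x hxF
  refine ⟨(norm_sub_le (κ g c r x) (cochT L a ψ lam κ g c r x)).trans ((add_le_add le_rfl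
    (by rw [hTeq.eq_of_nhds]; exact norm_sum_le _ _)).trans h1), ?_⟩
  rw [show (κ - cochT L a ψ lam κ) g c r = κ g c r - cochT L a ψ lam κ g c r from rfl,
    fderiv_sub hκd hTd]
  exact (norm_sub_le (fderiv ℝ (κ g c r) x) (fderiv ℝ (cochT L a ψ lam κ g c r) x)).trans
    ((add_le_add le_rfl (by
      rw [hTeq.fderiv_eq, fderiv_fun_sum fun γ hγ => (hT γ hγ).2.1 x hx]
      exact norm_sum_le (E := W →L[ℝ] W [⋀^Fin r]→L[ℝ] V) _ _)).trans h2)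

end Summit.Langlands.Langlands.Theorems.HeckeEigenvalueField.Res

end
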